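import Summits.HubbardSuperconductivity.HubbardSuperconductivity.Theorems.AnisotropyChordTransferFibre3RowDAtoms
import Summits.HubbardSuperconductivity.HubbardSuperconductivity.Theorems.AnisotropyChordTransferFibre3N1RowObjQKernel

/-!
# Route `AnisotropyChord` / H0 rotor rung, row D (KT-2a) Stage-1 evaluator: PHASES of integer points as `θ`-scaled pairs

The complex version of p2's `phase_re_toTor`: for an integer point `q` read on the torus and a nearest-neighbour vector `e ∈ E4`,
★ `phase_toTor_E4 : phase L (toTor q) (toTor e) = exp(i·θ·(q·e))`, `θ = 2π/L` (periodicity of `exp`: the `ZMod.val` exponent is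
congruent to `q·e` mod `L`); hence ★ `conj_phase_toTor_E4 : conj(phase) = exp(−iθ(q·e))`, the form produced by the row-D pair atom
`RowD.pphase (wE |m|) (sE |m|) m` at the true row-D vector (`peval_pphase`, `…RowDAtoms` value lemmas) — ★ `peval_phaseD`:
`phaseDpos n = e^{−iθn}`, `phaseDneg n = e^{+iθn}` at the true row-D vector (`1 ≤ n ≤ 3`).
Prover seat `hubbard-h0-rotor-p1` g29 (route lead); helper for piece A = stmt-HubbardSuperconductivity-23918 of rung 19089
(`--supports`, helper class).  Nothing here proves superconductivity in the Hubbard model; lemmas for ONE row of ONE conditional reduction;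
the rotor TARGET as originally worded stays FALSE (g15 verdict).  Tree imports only; no sorry.
-/

set_option linter.dupNamespace false
set_option autoImplicit false

open Literature.Analysis.ValidatedNumerics

namespace Summit.HubbardSuperconductivity.HubbardSuperconductivity.Theorems.AnisotropyChord.Transfer.Fibre3

namespace RowD

open RowC L2.N1

variable (L : ℕ) [NeZero L]

/-- `exp(2πi N/L)` depends only on `N mod L`. [folklore] -/
theorem exp_two_pi_I_of_modEq {N M : ℤ} (h : (N : ZMod L) = (M : ZMod L)) :
    Complex.exp (2 * Real.pi * Complex.I * ((N : ℂ) / (L : ℂ))) = Complex.exp (2 * Real.pi * Complex.I * ((M : ℂ) / (L : ℂ))) := by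
  have hL : (L : ℂ) ≠ 0 := by exact_mod_cast NeZero.ne L
  have hdvd : (L : ℤ) ∣ N - M := (ZMod.intCast_eq_intCast_iff_dvd_sub M N L).mp h.symm
  obtain ⟨k, hk⟩ := hdvd
  have e : (N : ℂ) = (M : ℂ) + (L : ℂ) * (k : ℂ) := by
    have : (N : ℤ) = M + L * k := by linarith
    exact_mod_cast this
  rw [e, show 2 * Real.pi * Complex.I * (((M : ℂ) + (L : ℂ) * (k : ℂ)) / (L : ℂ))
      = 2 * Real.pi * Complex.I * ((M : ℂ) / (L : ℂ)) + (k : ℂ) * (2 * Real.pi * Complex.I) by field_simp,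
    Complex.exp_add, Complex.exp_int_mul_two_pi_mul_I, mul_one]

/-- ★ `phase (toTor q) (toTor e) = exp(iθ(q·e))` for `e ∈ E4`, `θ = 2π/L`. [folklore] -/
theorem phase_toTor_E4 (q e : ℤ × ℤ) :
    phase L (B1.toTor L q) (B1.toTor L e)
      = Complex.exp (Complex.I * ((2 * Real.pi / L : ℝ) : ℂ) * ((qdot q e : ℤ) : ℂ)) := by
  unfold phase
  -- the `val` exponent is congruent to `q·e`
  set N : ℕ := (B1.toTor L q).1.val * (B1.toTor L e).1.val + (B1.toTor L q).2.val * (B1.toTor L e).2.val with hN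
  have hcong : ((N : ℤ) : ZMod L) = ((qdot q e : ℤ) : ZMod L) := by
    rw [hN]; unfold qdot B1.toTor
    push_cast
    simp only [ZMod.natCast_val, ZMod.cast_intCast']
  have h := exp_two_pi_I_of_modEq L hcong
  rw [Int.cast_natCast] at h
  rw [h]
  congr 1
  push_cast
  ring

/-- ★ the conjugate: `conj(phase (toTor q) (toTor e)) = exp(−iθ(q·e))`. [folklore] -/
theorem conj_phase_toTor_E4 (q e : ℤ × ℤ) :
    (starRingEnd ℂ) (phase L (B1.toTor L q) (B1.toTor L e))
      = Complex.exp (-(Complex.I * ((2 * Real.pi / L : ℝ) : ℂ) * ((qdot q e : ℤ) : ℂ))) := by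
  rw [phase_toTor_E4 L q e, ← Complex.exp_conj]
  congr 1
  simp only [map_mul, Complex.conj_I, Complex.conj_ofReal, map_intCast]
  ring

/-- the row-D phase atoms for `±n` (`1 ≤ n ≤ 3`): `e^{−iθn}` resp. `e^{+iθn}` as `pphase (wE n) (sE n) (±n)`. -/
def phaseDpos (n : ℕ) : RExpr × RExpr := pphase (wE n) (sE n) (n : ℤ)
/-- see `phaseDpos`. -/
def phaseDneg (n : ℕ) : RExpr × RExpr := pphase (wE n) (sE n) (-(n : ℤ))

/-- ★ at the true row-D vector, `phaseDpos n = e^{−iθn}` and `phaseDneg n = e^{+iθn}` (`1 ≤ n ≤ 3`, `L ≥ 3`). [folklore] -/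
theorem peval_phaseD (hL : 3 ≤ L) (Δ lam2 : ℝ) (f : Tor L → ℝ) (n : ℕ) (hn1 : 1 ≤ n) (hn3 : n ≤ 3) :
    peval (2 * Real.pi / L) (xTrueD L Δ lam2 f) (phaseDpos n)
      = Complex.exp (-(Complex.I * ((2 * Real.pi / L : ℝ) : ℂ) * ((n : ℤ) : ℂ))) ∧
    peval (2 * Real.pi / L) (xTrueD L Δ lam2 f) (phaseDneg n)
      = Complex.exp (-(Complex.I * ((2 * Real.pi / L : ℝ) : ℂ) * ((-(n : ℤ) : ℤ) : ℂ))) := by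
  have hLpos : (0 : ℝ) < L := by exact_mod_cast (show 0 < L by omega)
  have hθ : (2 * Real.pi / L : ℝ) ≠ 0 := by positivity
  have hnR : (n : ℝ) ≠ 0 := by exact_mod_cast (show n ≠ 0 by omega)
  have h0 := xTrueD_zero L Δ lam2 f
  have hw : (wE n).eval (xTrueD L Δ lam2 f) = (1 - Real.cos ((n : ℝ) * (2 * Real.pi / L))) / (2 * Real.pi / L) ^ 2 := by
    simp only [wE, RExpr.eval]; exact xTrueD_w L Δ lam2 f hn1 hn3
  have hs : (sE n).eval (xTrueD L Δ lam2 f) = Real.sin ((n : ℝ) * (2 * Real.pi / L)) / ((n : ℝ) * (2 * Real.pi / L)) := by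
    simp only [sE, RExpr.eval]; exact xTrueD_s L Δ lam2 f hn1 (by omega)
  constructor
  · apply peval_pphase (2 * Real.pi / L) (xTrueD L Δ lam2 f) h0 hθ
    · rw [hw]; push_cast; ring_nf
    · rw [hs]; push_cast; field_simp
  · apply peval_pphase (2 * Real.pi / L) (xTrueD L Δ lam2 f) h0 hθ
    · rw [hw]; push_cast
      rw [show -((n : ℝ)) * (2 * Real.pi / L) = -((n : ℝ) * (2 * Real.pi / L)) by ring, Real.cos_neg]
    · rw [hs]; push_cast
      rw [show -((n : ℝ)) * (2 * Real.pi / L) = -((n : ℝ) * (2 * Real.pi / L)) by ring, Real.sin_neg]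
      field_simp

end RowD

end Summit.HubbardSuperconductivity.HubbardSuperconductivity.Theorems.AnisotropyChord.Transfer.Fibre3
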